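import Mathlib
import Summits.Schanuel.Schanuel.Theses.RigidCore

/-! # Census §4 (Decomposition): candidate typed splits of (R), signatures only (elaboration check). -/

noncomputable section
open Complex IntermediateField

namespace Summit.Schanuel.Schanuel.Cruxes.SchanuelOnLogFreeCore.Census

/-- Child 1 of the SECTOR split — verbatim `GaussianStokesSector.PiFreeOverLWField` =
`ExceptionalSubspaces.PiFreeOverLWField` (ledger item stmt-Schanuel-9545, shared): π is
transcendental over the Lindemann–Weierstrass field. -/
def PiFreeOverLWField : Prop :=
  ∀ (d : ℕ) (a : Fin d → ℂ), (∀ i, IsAlgebraic ℚ (a i)) → LinearIndependent ℚ a →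
    ((d + 1 : ℕ) : Cardinal) ≤ Algebra.trdeg ℚ
      ↥(IntermediateField.adjoin ℚ (insert (Real.pi : ℂ) (Set.range (Complex.exp ∘ a))))

/-- Child 2 of the SECTOR split — `RelSchanuelOverPiLWField` (stmt-Schanuel-9548) RESTRICTED TO
CORE TUPLES: for x₁,…,xₙ in the log-free core, ℚ-linearly independent modulo V₂ = ℚ̄ ⊕ ℚπi, the
transcendence degree of K₂(x, eˣ) over K₂ = ℚ(ℚ̄ ∪ {πi} ∪ e^ℚ̄) is at least n. Implied by (R)
(finite-coefficient descent + (R) at (a, πi, x)); first open instances x = (π²) (e^{π²} ∉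
ℚ(π, e^ℚ̄)^alg ⊇ e^{π²} ∉ ℚ̄) and x = (e) (e^e ∉ ℚ(π, e^ℚ̄)^alg ⊇ e^e ∉ ℚ̄). -/
def CoreRelSchanuelOverPiLWField : Prop :=
  ∀ (n : ℕ) (x : Fin n → ℂ),
    (∀ i, x i ∈ (sInf {K : IntermediateField ℚ ℂ | (2 * ↑Real.pi * Complex.I : ℂ) ∈ K ∧
      (∀ w ∈ K, Complex.exp w ∈ K) ∧ ∀ w : ℂ, IsAlgebraic K w → w ∈ K} : IntermediateField ℚ ℂ)) →
    LinearIndependent ℚ ((Submodule.span ℚ ({z : ℂ | IsAlgebraic ℚ z} ∪ {(Real.pi : ℂ) * Complex.I})).mkQ ∘ x) →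
    (n : Cardinal) ≤ Algebra.trdeg
      ↥(IntermediateField.adjoin ℚ ({z : ℂ | IsAlgebraic ℚ z} ∪ {(Real.pi : ℂ) * Complex.I} ∪ Complex.exp '' {z : ℂ | IsAlgebraic ℚ z}))
      ↥(IntermediateField.adjoin ↥(IntermediateField.adjoin ℚ ({z : ℂ | IsAlgebraic ℚ z} ∪ {(Real.pi : ℂ) * Complex.I} ∪ Complex.exp '' {z : ℂ | IsAlgebraic ℚ z})) (Set.range x ∪ Set.range (Complex.exp ∘ x)))

/-- The glue the sector split would need (NOT proved here; = the sector reduction of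
ExceptionalSubspaces/GaussianStokesSector `Assembly`, stmt-Schanuel-9557, run on core tuples). -/
def SectorGlue : Prop :=
  PiFreeOverLWField → CoreRelSchanuelOverPiLWField →
    Summit.Schanuel.Schanuel.Theses.RigidCore.SchanuelOnLogFreeCore

/-- Child 1 of the VERTICAL split (leads c1–c3): Schanuel for tuples algebraic over `ℚ(π)`
(`SC|_{L₀}`, `L₀ = ℚ(2πi)^{ralg}`; ⟺ `stub_relLWZero` by `KernelTower.relLWZero_iff_schanuelOnStageZero`, p112355). -/
def SchanuelOverPiAlgebraic : Prop :=
  ∀ (n : ℕ) (x : Fin n → ℂ),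
    (∀ i, IsAlgebraic ↥(IntermediateField.adjoin ℚ {(2 * ↑Real.pi * Complex.I : ℂ)}) (x i)) →
    LinearIndependent ℚ x →
    (n : Cardinal) ≤ Algebra.trdeg ℚ ↥(IntermediateField.adjoin ℚ (Set.range x ∪ Set.range (Complex.exp ∘ x)))

/-- Child 2 of the VERTICAL split in tower-free form: HEREDITY — for every relatively algebraically
closed subfield K of the core containing 2πi, Schanuel on K-tuples implies Schanuel on tuples
algebraic over K(exp K). (With child 1 and core exhaustion `mem_logFreeCore_iff_exists_stage` this
gives (R) by induction on the stage; implied by (R) outright.) -/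
def CoreHeredity : Prop :=
  ∀ K : IntermediateField ℚ ℂ,
    (2 * ↑Real.pi * Complex.I : ℂ) ∈ K → (∀ w : ℂ, IsAlgebraic K w → w ∈ K) →
    K ≤ (sInf {K : IntermediateField ℚ ℂ | (2 * ↑Real.pi * Complex.I : ℂ) ∈ K ∧
      (∀ w ∈ K, Complex.exp w ∈ K) ∧ ∀ w : ℂ, IsAlgebraic K w → w ∈ K} : IntermediateField ℚ ℂ) →
    (∀ (n : ℕ) (x : Fin n → ℂ), (∀ i, x i ∈ K) → LinearIndependent ℚ x →
      (n : Cardinal) ≤ Algebra.trdeg ℚ ↥(IntermediateField.adjoin ℚ (Set.range x ∪ Set.range (Complex.exp ∘ x)))) →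
    ∀ (n : ℕ) (x : Fin n → ℂ),
      (∀ i, IsAlgebraic ↥(IntermediateField.adjoin ℚ ((K : Set ℂ) ∪ Complex.exp '' (K : Set ℂ))) (x i)) →
      LinearIndependent ℚ x →
      (n : Cardinal) ≤ Algebra.trdeg ℚ ↥(IntermediateField.adjoin ℚ (Set.range x ∪ Set.range (Complex.exp ∘ x)))

/-- Strengthening S⁺₁ (census §3): `H_π` — π is not ∅-definable in the real exponential field
(cards real-reduct-generic-pi / real-leaf-genericity; KMO 2012 open question). -/
def PiNotRealExpDefinable : Prop :=
  ¬ ∃ s : Set ℝ, s = {Real.pi} ∧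
    Set.Definable₁ (∅ : Set ℝ) Literature.ModelTheory.ExponentialFields.Language.expRing s

end Summit.Schanuel.Schanuel.Cruxes.SchanuelOnLogFreeCore.Census
end
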